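import Mathlib
import Literature.MathematicalPhysics.QuantumFieldTheory.Balaban1983to89.B15LatticeCubeContours

/-!
# `Balaban1983to89.B15LatticeCubeTorus` — [Balaban1984PropagatorsII] Lemma 2.1 (2.60)–(2.63) with the d-only constant
# c₁″ = 13c₀(½α)^{4d} for print's multiscale distance (2.46) read literally (reading R0) ON THE TORUS T_η — print's own
# setting, p. 224 *«Ω_j ⊂ T_η»*, contours with WRAP-AROUND — for the [IV] cube carrier, by the UNIVERSAL COVER: the ℤᵈ files
# `B15LatticeCubeContours` / `B15TouchingCubeContours` / `B15Ineq147LevelGap` are the cover, this file is the quotient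

statement-level skeleton of published theorems with citation tags; proofs where landed; nothing here is a claim about the Yang–Mills mass gap

CITATION HEADER (lean-in-tree rule 2026-08-18).  Sources: T. Bałaban, *Propagators and renormalization transformations for
lattice gauge theories. II*, Commun. Math. Phys. **96**, 223–250 (1984) [Balaban1984PropagatorsII] (cell paper B6; PDF held
`paper:balaban1984-cmp96-propagators-rt-ii`, journal page = PDF page + 222; p. 224 [PDF 2] and pp. 231–234 [PDF 9–12] re-read
this generation from the text layer `p0002.txt`, `p0009.txt`–`p0012.txt`); T. Bałaban, *Propagators and renormalization
transformations for lattice gauge theories. I*, Commun. Math. Phys. **95**, 17–40 (1984) [Balaban1984PropagatorsI] (B5; PDF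
held `paper:balaban1984-cmp95-propagators-rt-i`, p. 17 [PDF 1] read: the torus); T. Bałaban, *Large field renormalization. I*,
Commun. Math. Phys. **122**, 175–202 (1989) [Balaban1989LargeFieldI] (B15 = [IV]; p. 179 the nested `Z″_n`, p. 186 the cube
model and (1.47) — as typed by r12/p29 in `B15Ineq147LevelGap`); T. Bałaban, *Convergent renormalization expansions …*, Commun.
Math. Phys. **119** (1988) [Balaban1988Convergent] ((2.13) admissible sequences, as typed by r11).  WHAT IS REPRODUCED:
lit-balaban SKELETON rows **B6.Lem2.1**, **B6.Eq2.45**/(2.46) (cells; heads unchanged — the printed c₁(α) stays refuted as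
typed; owner r03: B6-CLOSURE «WHAT IS LEFT (v) torus wrap-around for p29's R0 Lemma 2.1»), **B15.Eq1.47** geometric input on
the torus (owner r12).  Mega-formalization `lit-balaban`, HOME `run/shared/lean/pub/lit-balaban/`; Phase-2 proof seat p29
gen 13 (unit `lit-balaban-p29`), free-target protocol G.5-34(d), item (i) of the p29 gen-12 HANDOFF menu; v1 = p321735
(ACCEPTED e38ee3777036), v1.1 = §6 appended (theorems + one definition with body `periodize`).  KNITTING — used BY
NAME, nothing restated: `B15LatticeCubeContours.{latC, latC_adj, LatStep, cornerC, sideZ, cornerC_injective, latC_connected,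
separates_latC, levelGap_latC, sum_exp_le_latC}` (p29 g12, p319887/p320264), `B15Ineq147LevelGap.{cube, corner, CubeSite,
zoneC, corner_mem_layer, LayerSepZd, length_ge_mul_of_levelGap}` (p299858), `B15TouchingCubeContours.{Tiles, tiles_of_layers}`
(p314807), `B15TouchingCubeDomains.tiles_of_admissible` (p315190), `B15Ineq147Admissible.{monotone_compl_of_admissible,
layerSepZd_of_admissible}` (p301778), r11 `B14DomainGeom.{cubeIdx, IsUnionOfCubes, Within}`, `B14.Eq213MaximalDomains.side`,
pv08/r03 `B6Geometry.{Separates, LevelGap, ContourSystem, Realizes, ineq260_of_levelGap, triangle254_of_realizes}`,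
`B6Lemma21TwoScale.{c1TwoScale, Lemma21TwoScale, lemma21TwoScale_of_ineq261T, lemma21TwoScale_full}`,
`B6Lemma21Repaired.Ineq26xWith`, `B6RandomWalk.{Ineq260, Triangle254}`, `B6.Cond259`, `B6.c0`.

THE PRINTED TEXT.  [B5] p. 17 [PDF 1]: *«T_ε … is a d-dimensional torus which we identify with the subset {x ∈ εℤᵈ :
−L_μ ≤ x_μ < L_μ, μ = 1, …, d} of the lattice εℤᵈ.»*  [B6] p. 224 [PDF 2]: *«Ω₁ ⊃ Ω₂ ⊃ … ⊃ Ω_k, Ω_j ⊂ T_η, j = 1, 2, …, k,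
(2.1) … Ω_j = B^j(Ω_j^{(j)}), Ω_j^{(j)} ⊂ T^{(j)}_η and it is a sum of big blocks, (L^jη)^{−1}dist(Ω^c_j, Ω_{j+1}) > RM … The
above sets are subsets of T_η, thus sets of sites of this lattice … T = ⋃_{j=0}^k B^j(Λ_j) (2.4) … we admit the case when some
domains Ω_j are equal to T_η»*; p. 231 [PDF 9]: *«We consider a special class of contours Γ. They have the property that a part
of Γ contained in B^j(Λ_j) consists of bonds of the lattice Λ_j. Now we define d(y, y′) = inf_Γ Σ_j (L^jη)^{−1}|Γ_{y,y′} ∩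
B^j(Λ_j)| (2.46)»*; p. 234 [PDF 12]: Lemma 2.1 (2.60)–(2.63) (verbatim = docstring of `B6.Lemma21Printed`).  [IV] p. 179
[PDF 5]: the nested `Z″_n`, *«separated by one layer of M-cubes … and so on»*; p. 186 [PDF 12]: (1.47), the distance *«defined
in terms of M₁-cubes on corresponding scales»*.

THE MODEL AND THE MECHANISM (ours, declared).  The torus is `T = ℤᵈ/∏_μ P_μℤ` (periods `P_μ ≥ 1` in units of the finest lattice;
print's `P_μ = 2L_μ/ε`), presented by its universal cover ℤᵈ: a nested torus family `Z″` is the same thing as a nested family on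
ℤᵈ invariant under the deck translations `x ↦ x + (P_μv_μ)_μ`, `v ∈ ℤᵈ`, and — since every block size divides the periods, as on
print's tori — a cube of `T` is the same thing as an orbit of cubes of the cover (`IsPeriodic`: invariance, positivity,
divisibility; a `Prop`, no data).  Torus cube-sites `TSite` = the cover's cube-sites with corner in the fundamental box
`∏[0, P_μ)` (one per orbit: `proj`, `eq_of_shift_eq`); the TORUS CONTOUR GRAPH `torC` = the quotient of the cover's
lattice-contour graph `latC` (reading R0 of GAPS G-B6-22: a bond = one bond of the lattice of one of the two cubes) by the
deck group — two torus cubes are joined iff some lifts are joined; wrap-around bonds are exactly the bonds between lifts in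
different period cells.  Deck translations are automorphisms of `latC` (`latC_adj_shift`, `dist_shift`), so CONTOURS LIFT
AND PROJECT (`exists_walk_lift`, `exists_walk_proj`): the torus distance (2.46) is the least cover distance over the lifts
(`exists_lift_dist_eq`, `torC_dist_eq_iInf`), `torC` is connected, and `Separates` / the walk form `LevelGap (M/M₁)` of
(2.2)/(2.57) transfer from the cover (`separates_torC`, `levelGap_torC`, `walk_length_ge_torC` = the (1.47) input on `T`).
(2.61″) ON THE TORUS is then a TRANSFER, nothing re-derived: in the row of `y`, lift every torus site `y′` to a cover site at
cover distance = torus distance; distinct torus sites have distinct lifts, so the torus row IS a row of a cover geometry and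
`B15LatticeCubeContours.sum_exp_le_latC` (d-only constant, (2.59)) bounds it (`ineq261T_torGeo`).

WHAT THIS FILE PROVES (kernel-checked, zero `sorry`; one `Prop`-valued hypothesis structure `IsPeriodic`; definitions with
bodies `pmul`, `qmul`, `shift`, `shiftHom`, `InBox`, `TSite`, `redV`, `proj`, `torC`, `zoneT`, `cellA`, `twoScaleZ`; three
reducible `B6.Geometry`/`ContourSystem` models `torGeo`, `liftGeo`, `torSystem`; theorems otherwise; no named fact; axioms
standard).
§1 the cover: `IsPeriodic`, `mem_cube_add_qmul`, `corner_add_qmul`, **`shift`** (deck translation of cube-sites), `cornerC_shift`,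
   `shift_zero`/`shift_add`/`shift_neg_shift`/`shift_injective` (a ℤᵈ-action), `latStep_shift`, **`latC_adj_shift`**, `shiftHom`,
   `reachable_shift_iff`, **`dist_shift`** (the cover's contour distance is translation invariant).
§2 the torus: `TSite`, `redV`, `inBox_add_pmul_redV`, **`proj`**, `proj_shift`, `proj_coe`, `eq_of_inBox_of_add_pmul`,
   **`eq_of_shift_eq`** (distinct torus sites = distinct orbits), **`torC`**, `torC_adj`, `torC_adj_proj`, **`exists_walk_proj`**,
   **`exists_walk_lift`**, `torC_dist_le_lift`, **`torC_connected`**, **`exists_lift_dist_eq`**, `separates_torC`,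
   **`levelGap_torC`**, `walk_length_ge_torC`, `torC_dist_eq_iInf`.
§3 `torGeo`, `torSystem`, `realizes_torGeo`, `liftGeo`, `ineq260_torGeo`, `triangle254_torGeo`, **`ineq261T_torGeo`** ((2.61″) on
   `T`), **`lemma21TwoScale_torGeo`**, **`lemma21_full_torGeo`** (all four displays (2.60)–(2.63) with c₁″ on the torus cube
   carrier, hypotheses: `IsPeriodic`, `Monotone Z″`, `LayerSepZd Z″ M L`, `Tiles`, `1 ≤ M₁ ≤ M`, `L ≥ 2`, `R·M_r ≤ M/M₁`,
   `2 ≤ M/M₁`, `δ₀ > 0`, 0 < α < 1, (2.59)), `sum_exp_le_torC` (the row sum as a number, volume-independent).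
§4 `lemma21TwoScale_torGeo_family` (ONE constant uniformly over any family of tori — print's index `(k, T_η)`; the shape
   `DagBinding.b6Lemma21Param_of_twoScale` consumes), `finite_TSite` (𝔅 = all cube-sites of `T` is a legitimate `F`),
   `isPeriodic_of_top`, `isPeriodic_of_admissible`, **`lemma21_full_torGeo_admissible`** (over any periodic [III]
   (2.13)-admissible sequence with finitely many scales `Ω_{K+1} = ∅`, `M₁L^K ∣ P_μ`).
§5 non-vacuity: the two-scale torus `twoScaleZ` (a periodic array of coarse cells `cellA` refined into finer cubes; periods
   `M₁L^K·N`): `monotone_/layerSepZd_/tiles_/isPeriodic_twoScaleZ`, **`lemma21_full_torGeo_twoScale`** (numerics only).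
§6 (v1.1, append-only) PERIODIZATION: `periodize` (union of the deck translates), `subset_periodize`, `periodize_mem_iff`,
   `periodize_univ`/`_empty`, **`hdistD_periodize`** (r11's separation (2.13) survives), `cubeIdx_sub_pmul`,
   **`isUnionOfCubes_periodize`**, `isUnionOfCubes_periodize_admissible`, `isPeriodic_periodize`,
   **`lemma21_full_torGeo_periodize`** — the torus Lemma 2.1 for the periodization of ANY [III] (2.13)-admissible sequence of
   the cover with finitely many scales (`Ω_{K+1} = ∅`, `L^K·M ∣ P_μ`): r11's non-periodic admissible sequences are consumed
   directly, one period cell at a time.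
HONEST SCOPE.  (i) The torus is presented by its universal cover with the fundamental box `∏[0,P_μ)` (print's `[−L_μ, L_μ)` is
another choice of representatives of the same orbits); `IsPeriodic.dvd` is print's standing arrangement that block sizes
divide the torus sides.  (ii) The contour reading is R0 of GAPS G-B6-22 (print-literal), inherited from the cover; the constant
is the lineage's corrected d-only c₁″ under (2.59), NOT the printed 12c₀(½α)^d (refuted as typed, unchanged); `2 ≤ M/M₁` is the
cover's reconstruction hypothesis (`B6Decomp247LatticeTwoSided` TYPING (c)).  (iii) The (2.61″) transfer uses only
orbit-injectivity of the lifts — valid for every period, including tori so small that a cube is joined to its own translate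
(such bonds project to no bond, `torC` being loopless).  (iv) The non-vacuity witness §5 has two scales, where the one-layer
separation is void; the separation/level-gap mechanism is exercised non-vacuously (≥ 3 scales) on the cover by
`B15TouchingCubeDomains.nestedZ` (not periodic); a periodic witness with ≥ 3 scales is not constructed here.  (v) Finite
lattice geometry feeding the bookkeeping Lemma 2.1 of a published proof as repaired in the tree; NOT the printed constant,
NOT progress on any Clay problem.
-/

namespace Literature.MathematicalPhysics.QuantumFieldTheory.Balaban1983to89.B15LatticeCubeTorus

open Literature.MathematicalPhysics.QuantumFieldTheory.Balaban1983to89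
open B6Geometry B15Ineq147LevelGap B15Ineq147Admissible B14DomainGeom B15TouchingCubeContours B15TouchingCubeDomains
  B15LatticeCubeContours

variable {d : ℕ} {M₁ L : ℕ} {Z : ℕ → Set (Fin d → ℤ)} {P : Fin d → ℕ}

/-! ## §1 The universal cover: periodic nested families and the deck translations of the ℤᵈ cube model -/

/-- The translation vector `(P_μ v_μ)_μ` of the deck transformation `v ∈ ℤᵈ` of the cover `ℤᵈ → T = ℤᵈ/∏_μ P_μℤ` (print's torus
*«{x ∈ εℤᵈ : −L_μ ≤ x_μ < L_μ, μ = 1, …, d}»* has `P_μ = 2L_μ/ε` in lattice units). [cite: Balaban1984PropagatorsI, Sect. A p.17; Balaban1984PropagatorsII, (2.1) p.224] -/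
def pmul (P : Fin d → ℕ) (v : Fin d → ℤ) : Fin d → ℤ := fun μ => (P μ : ℤ) * v μ

/-- The same translation on the INDICES of the scale-`n` cubes (side `M₁Lⁿ ∣ P_μ`): `((P_μ/(M₁Lⁿ)) v_μ)_μ`.
[cite: Balaban1989LargeFieldI, p.179, p.186] -/
def qmul (M₁ L : ℕ) (P : Fin d → ℕ) (n : ℕ) (v : Fin d → ℤ) : Fin d → ℤ :=
  fun μ => ((P μ / (M₁ * L ^ n) : ℕ) : ℤ) * v μ

/-- Unfolding of `pmul` at a coordinate. [folklore] -/
@[simp] private theorem pmul_apply (P : Fin d → ℕ) (v : Fin d → ℤ) (μ : Fin d) : pmul P v μ = (P μ : ℤ) * v μ := rfl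

/-- The trivial deck translation moves no index. [folklore] -/
@[simp] private theorem qmul_zero (M₁ L : ℕ) (P : Fin d → ℕ) (n : ℕ) : qmul M₁ L P n (0 : Fin d → ℤ) = 0 := by
  funext μ; simp [qmul]

/-- Index translations add. [folklore] -/
private theorem qmul_add (M₁ L : ℕ) (P : Fin d → ℕ) (n : ℕ) (v w : Fin d → ℤ) :
    qmul M₁ L P n (v + w) = qmul M₁ L P n v + qmul M₁ L P n w := by
  funext μ; simp [qmul, mul_add]

/-- **THE NESTED FAMILY IS THE PULL-BACK OF A FAMILY ON THE TORUS** `T = ℤᵈ/∏_μ P_μℤ` (print's setting: *«Ω₁ ⊃ Ω₂ ⊃ … ⊃ Ω_k,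
Ω_j ⊂ T_η … The above sets are subsets of T_η, thus sets of sites of this lattice»*, T_η the torus of [Balaban1984PropagatorsI]
Sect. A): every `Z″_n ⊂ ℤᵈ` is invariant under the deck translations, the periods are positive, and every cube of the model has a
side dividing the periods (print's tori have sides that are multiples of all block sizes, (2.1) *«it is a sum of big blocks»*).
A `Prop`-valued bundle of hypotheses, no data. [cite: Balaban1984PropagatorsII, (2.1)–(2.4) p.224; Balaban1984PropagatorsI, Sect. A p.17; Balaban1989LargeFieldI, p.179] -/
structure IsPeriodic (M₁ L : ℕ) (Z : ℕ → Set (Fin d → ℤ)) (P : Fin d → ℕ) : Prop where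
  pos : ∀ μ, 0 < P μ
  mem_iff : ∀ (n : ℕ) (x v : Fin d → ℤ), x + pmul P v ∈ Z n ↔ x ∈ Z n
  dvd : ∀ (s : CubeSite M₁ L Z) (μ : Fin d), M₁ * L ^ zoneC s ∣ P μ

/-- Translating the index of a scale-`n` cube by `(P/(M₁Lⁿ))·v` translates the cube by `P·v` (`M₁Lⁿ ∣ P_μ`).
[cite: Balaban1989LargeFieldI, p.186] -/
theorem mem_cube_add_qmul {n : ℕ} (hd : ∀ μ, M₁ * L ^ n ∣ P μ) {c v x : Fin d → ℤ} :
    x ∈ cube M₁ L n (c + qmul M₁ L P n v) ↔ x - pmul P v ∈ cube M₁ L n c := by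
  have key : ∀ μ, ((M₁ * L ^ n : ℕ) : ℤ) * (c + qmul M₁ L P n v) μ = ((M₁ * L ^ n : ℕ) : ℤ) * c μ + pmul P v μ := by
    intro μ
    have h1 : ((M₁ * L ^ n : ℕ) : ℤ) * ((P μ / (M₁ * L ^ n) : ℕ) : ℤ) = (P μ : ℤ) := by
      exact_mod_cast Nat.mul_div_cancel' (hd μ)
    simp only [Pi.add_apply, qmul, pmul]
    rw [mul_add, ← mul_assoc, h1]
  simp only [cube, Set.mem_setOf_eq, Pi.sub_apply]
  refine forall_congr' fun μ => ?_
  have e1 : ((M₁ * L ^ n : ℕ) : ℤ) * ((c + qmul M₁ L P n v) μ + 1) =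
      ((M₁ * L ^ n : ℕ) : ℤ) * (c μ + 1) + pmul P v μ := by
    rw [mul_add, key μ]; ring
  rw [key μ, e1]
  constructor <;> rintro ⟨h1, h2⟩ <;> constructor <;> linarith

/-- The corner of the translated cube is the translated corner. [cite: Balaban1989LargeFieldI, p.186] -/
theorem corner_add_qmul {n : ℕ} (hd : ∀ μ, M₁ * L ^ n ∣ P μ) (c v : Fin d → ℤ) :
    corner M₁ L n (c + qmul M₁ L P n v) = corner M₁ L n c + pmul P v := by
  funext μ
  have h1 : ((M₁ * L ^ n : ℕ) : ℤ) * ((P μ / (M₁ * L ^ n) : ℕ) : ℤ) = (P μ : ℤ) := by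
    exact_mod_cast Nat.mul_div_cancel' (hd μ)
  simp only [corner, Pi.add_apply, qmul, pmul]
  rw [mul_add, ← mul_assoc, h1]

/-- **THE DECK TRANSLATION `v ∈ ℤᵈ` ON CUBE-SITES**: the scale-`n` cube of index `c` in the layer `Z″_{n+1}∖Z″_n` goes to the
scale-`n` cube of index `c + (P/(M₁Lⁿ))·v`, which lies in the same layer by periodicity. [cite: Balaban1984PropagatorsII, (2.1)–(2.4) p.224; Balaban1989LargeFieldI, p.179] -/
def shift (h : IsPeriodic M₁ L Z P) (v : Fin d → ℤ) (s : CubeSite M₁ L Z) : CubeSite M₁ L Z :=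
  ⟨(s.1.1, s.1.2 + qmul M₁ L P s.1.1 v), fun x hx => by
    have hx' : x - pmul P v ∈ cube M₁ L s.1.1 s.1.2 := (mem_cube_add_qmul (fun μ => h.dvd s μ)).mp hx
    have hl := s.2 hx'
    have e : x - pmul P v + pmul P v = x := sub_add_cancel x (pmul P v)
    refine ⟨?_, fun hmem => hl.2 ?_⟩
    · have := (h.mem_iff (s.1.1 + 1) (x - pmul P v) v).mpr hl.1
      rwa [e] at this
    · have := (h.mem_iff s.1.1 (x - pmul P v) v).mp (by rwa [e])
      exact this⟩

variable {h : IsPeriodic M₁ L Z P}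

/-- A deck translation keeps the scale. [cite: Balaban1984PropagatorsII, (2.45) p.231] -/
@[simp] theorem zoneC_shift (v : Fin d → ℤ) (s : CubeSite M₁ L Z) : zoneC (shift h v s) = zoneC s := rfl

/-- The scale component, as a pair projection. [cite: Balaban1984PropagatorsII, (2.45) p.231] -/
@[simp] theorem shift_fst (v : Fin d → ℤ) (s : CubeSite M₁ L Z) : (shift h v s).1.1 = s.1.1 := rfl

/-- The index component. [cite: Balaban1989LargeFieldI, p.186] -/
@[simp] theorem shift_snd (v : Fin d → ℤ) (s : CubeSite M₁ L Z) : (shift h v s).1.2 = s.1.2 + qmul M₁ L P s.1.1 v := rfl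

/-- **The corner moves by the period vector**: `corner (v·s) = corner s + P·v`. [cite: Balaban1984PropagatorsI, Sect. A p.17; Balaban1989LargeFieldI, p.186] -/
theorem cornerC_shift (v : Fin d → ℤ) (s : CubeSite M₁ L Z) : cornerC (shift h v s) = cornerC s + pmul P v := by
  change corner M₁ L s.1.1 (s.1.2 + qmul M₁ L P s.1.1 v) = corner M₁ L s.1.1 s.1.2 + pmul P v
  exact corner_add_qmul (fun μ => h.dvd s μ) _ _

/-- The trivial deck translation. [cite: Balaban1984PropagatorsI, Sect. A p.17] -/
@[simp] theorem shift_zero (s : CubeSite M₁ L Z) : shift h 0 s = s := by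
  apply Subtype.ext
  ext <;> simp

/-- Deck translations compose additively (a ℤᵈ-action). [cite: Balaban1984PropagatorsI, Sect. A p.17] -/
theorem shift_add (v w : Fin d → ℤ) (s : CubeSite M₁ L Z) : shift h (v + w) s = shift h v (shift h w s) := by
  apply Subtype.ext
  refine Prod.ext rfl ?_
  simp only [shift_snd, shift_fst, qmul_add]
  abel

/-- … hence are invertible. [cite: Balaban1984PropagatorsI, Sect. A p.17] -/
theorem shift_neg_shift (v : Fin d → ℤ) (s : CubeSite M₁ L Z) : shift h (-v) (shift h v s) = s := by
  rw [← shift_add, neg_add_cancel, shift_zero]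

/-- … and, the other way round. [cite: Balaban1984PropagatorsI, Sect. A p.17] -/
theorem shift_shift_neg (v : Fin d → ℤ) (s : CubeSite M₁ L Z) : shift h v (shift h (-v) s) = s := by
  rw [← shift_add, add_neg_cancel, shift_zero]

/-- … hence injective. [cite: Balaban1984PropagatorsI, Sect. A p.17] -/
theorem shift_injective (v : Fin d → ℤ) : Function.Injective (shift h v) := fun s t hst => by
  have := congrArg (shift h (-v)) hst
  rwa [shift_neg_shift, shift_neg_shift] at this

/-- **A lattice bond translates to a lattice bond** (the corner displacement `M₁L^{zone s}·e_μ` is translation invariant).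
[cite: Balaban1984PropagatorsII, (2.46) p.231] -/
theorem latStep_shift (v : Fin d → ℤ) {s t : CubeSite M₁ L Z} (hst : LatStep s t) : LatStep (shift h v s) (shift h v t) := by
  obtain ⟨μ, hμ⟩ := hst
  refine ⟨μ, ?_⟩
  rw [cornerC_shift, cornerC_shift, hμ, zoneC_shift]
  abel

/-- **Deck translations are automorphisms of the lattice contour graph** `latC` (adjacency is preserved; with the inverse
translation, reflected). [cite: Balaban1984PropagatorsII, (2.46) p.231; Balaban1984PropagatorsI, Sect. A p.17] -/
theorem latC_adj_shift (v : Fin d → ℤ) {s t : CubeSite M₁ L Z} (hst : (latC M₁ L Z).Adj s t) :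
    (latC M₁ L Z).Adj (shift h v s) (shift h v t) := by
  obtain ⟨hne, h1 | h2⟩ := latC_adj.mp hst
  · exact latC_adj.mpr ⟨fun e => hne (shift_injective v e), Or.inl (latStep_shift v h1)⟩
  · exact latC_adj.mpr ⟨fun e => hne (shift_injective v e), Or.inr (latStep_shift v h2)⟩

/-- The deck translation as a graph homomorphism of `latC` (so that contours translate: `SimpleGraph.Walk.map`).
[cite: Balaban1984PropagatorsII, (2.46) p.231] -/
def shiftHom (h : IsPeriodic M₁ L Z P) (v : Fin d → ℤ) : latC M₁ L Z →g latC M₁ L Z :=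
  ⟨shift h v, fun hst => latC_adj_shift v hst⟩

/-- Unfolding of `shiftHom`. [folklore] -/
@[simp] private theorem shiftHom_apply (v : Fin d → ℤ) (s : CubeSite M₁ L Z) : shiftHom h v s = shift h v s := rfl

/-- Contours translate: reachability is translation invariant. [cite: Balaban1984PropagatorsII, (2.46) p.231] -/
theorem reachable_shift_iff (v : Fin d → ℤ) (s t : CubeSite M₁ L Z) :
    (latC M₁ L Z).Reachable (shift h v s) (shift h v t) ↔ (latC M₁ L Z).Reachable s t := by
  constructor
  · rintro ⟨p⟩
    have q := p.map (shiftHom h (-v))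
    rw [shiftHom_apply, shiftHom_apply, shift_neg_shift, shift_neg_shift] at q
    exact ⟨q⟩
  · rintro ⟨p⟩
    exact ⟨p.map (shiftHom h v)⟩

/-- One direction of the invariance of the contour distance. [cite: Balaban1984PropagatorsII, (2.46) p.231] -/
theorem dist_shift_le (v : Fin d → ℤ) (s t : CubeSite M₁ L Z) :
    (latC M₁ L Z).dist (shift h v s) (shift h v t) ≤ (latC M₁ L Z).dist s t := by
  by_cases hr : (latC M₁ L Z).Reachable s t
  · obtain ⟨p, hp⟩ := hr.exists_walk_length_eq_dist
    have := SimpleGraph.dist_le (p.map (shiftHom h v))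
    rwa [SimpleGraph.Walk.length_map, hp] at this
  · have hr' : ¬ (latC M₁ L Z).Reachable (shift h v s) (shift h v t) := fun h' => hr ((reachable_shift_iff v s t).mp h')
    rw [SimpleGraph.dist_eq_zero_of_not_reachable hr, SimpleGraph.dist_eq_zero_of_not_reachable hr']

/-- **THE CONTOUR DISTANCE (2.46) ON THE COVER IS TRANSLATION INVARIANT.** [cite: Balaban1984PropagatorsII, (2.46) p.231] -/
theorem dist_shift (v : Fin d → ℤ) (s t : CubeSite M₁ L Z) :
    (latC M₁ L Z).dist (shift h v s) (shift h v t) = (latC M₁ L Z).dist s t := by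
  refine le_antisymm (dist_shift_le v s t) ?_
  have := dist_shift_le (h := h) (-v) (shift h v s) (shift h v t)
  rwa [shift_neg_shift, shift_neg_shift] at this

/-! ## §2 The torus: cube-sites of `T` (= orbits, represented in the fundamental box), the quotient contour graph `torC`,
path lifting, and the transfer of `Separates` / `LevelGap` / connectedness -/

/-- The fundamental box `∏_μ [0, P_μ)` of the cover (print's *«−L_μ ≤ x_μ < L_μ»* up to the choice of representatives).
[cite: Balaban1984PropagatorsI, Sect. A p.17] -/
def InBox (P : Fin d → ℕ) (x : Fin d → ℤ) : Prop := ∀ μ, 0 ≤ x μ ∧ x μ < P μ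

/-- **THE CUBE-SITES OF THE TORUS** `T`: the scale-`n` cubes of the layers of the torus family — equivalently the orbits of the
deck group on the cube-sites of the cover, represented by the cube-sites whose corner lies in the fundamental box (every cube
side divides the periods, so a cube of the cover projects onto a cube of `T`).  This is print's generating set
𝔅 = ⋃_j Λ_j ⊂ T_η of (2.45) for the [IV] cube carrier. [cite: Balaban1984PropagatorsII, (2.45) p.231, (2.1)–(2.4) p.224; Balaban1989LargeFieldI, p.179, p.186] -/
def TSite (M₁ L : ℕ) (Z : ℕ → Set (Fin d → ℤ)) (P : Fin d → ℕ) : Type :=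
  {s : CubeSite M₁ L Z // InBox P (cornerC s)}

/-- The deck translation bringing a lattice point into the fundamental box: `v_μ = −⌊x_μ/P_μ⌋`. [cite: Balaban1984PropagatorsI, Sect. A p.17] -/
def redV (P : Fin d → ℕ) (x : Fin d → ℤ) : Fin d → ℤ := fun μ => -(x μ / (P μ : ℤ))

/-- `x + P·v(x)` is the residue of `x` modulo the periods, a point of the fundamental box. [cite: Balaban1984PropagatorsI, Sect. A p.17] -/
theorem inBox_add_pmul_redV (hP : ∀ μ, 0 < P μ) (x : Fin d → ℤ) : InBox P (x + pmul P (redV P x)) := by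
  intro μ
  have hPμ : (0 : ℤ) < P μ := by exact_mod_cast hP μ
  have e : (x + pmul P (redV P x)) μ = x μ % (P μ : ℤ) := by
    simp only [Pi.add_apply, pmul, redV, mul_neg]
    rw [Int.emod_def]
    ring
  rw [e]
  exact ⟨Int.emod_nonneg _ hPμ.ne', Int.emod_lt_of_pos _ hPμ⟩

/-- The reduction vector of a translated point. [cite: Balaban1984PropagatorsI, Sect. A p.17] -/
theorem redV_add_pmul (hP : ∀ μ, 0 < P μ) (x v : Fin d → ℤ) : redV P (x + pmul P v) = redV P x - v := by
  funext μ
  have hPμ : (P μ : ℤ) ≠ 0 := by exact_mod_cast (hP μ).ne'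
  simp only [redV, Pi.add_apply, Pi.sub_apply, pmul]
  rw [Int.add_mul_ediv_left _ _ hPμ]
  ring

/-- A point of the fundamental box needs no reduction. [cite: Balaban1984PropagatorsI, Sect. A p.17] -/
theorem redV_eq_zero_of_inBox {x : Fin d → ℤ} (hx : InBox P x) : redV P x = 0 := by
  funext μ
  simp only [redV, Pi.zero_apply, neg_eq_zero]
  exact Int.ediv_eq_zero_of_lt (hx μ).1 (hx μ).2

/-- **THE COVERING PROJECTION** on cube-sites: translate into the fundamental box. [cite: Balaban1984PropagatorsI, Sect. A p.17; Balaban1984PropagatorsII, (2.45) p.231] -/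
def proj (h : IsPeriodic M₁ L Z P) (s : CubeSite M₁ L Z) : TSite M₁ L Z P :=
  ⟨shift h (redV P (cornerC s)) s, by
    rw [cornerC_shift]
    exact inBox_add_pmul_redV h.pos _⟩

/-- The projection, unfolded. [cite: Balaban1984PropagatorsII, (2.45) p.231] -/
theorem proj_val (s : CubeSite M₁ L Z) : (proj h s).1 = shift h (redV P (cornerC s)) s := rfl

/-- **The projection is invariant under deck translations** (orbits ↦ one representative). [cite: Balaban1984PropagatorsI, Sect. A p.17] -/
theorem proj_shift (v : Fin d → ℤ) (s : CubeSite M₁ L Z) : proj h (shift h v s) = proj h s := by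
  apply Subtype.ext
  rw [proj_val, proj_val, cornerC_shift, redV_add_pmul h.pos, ← shift_add, sub_add_cancel]

/-- A torus site is its own representative. [cite: Balaban1984PropagatorsI, Sect. A p.17] -/
theorem proj_coe (a : TSite M₁ L Z P) : proj h a.1 = a := by
  apply Subtype.ext
  rw [proj_val, redV_eq_zero_of_inBox a.2, shift_zero]

/-- Every cube-site of the cover is a deck translate of its projection. [cite: Balaban1984PropagatorsI, Sect. A p.17] -/
theorem eq_shift_proj (s : CubeSite M₁ L Z) : s = shift h (-redV P (cornerC s)) (proj h s).1 := by
  rw [proj_val, shift_neg_shift]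

/-- Two points of the fundamental box differing by a period vector are equal (and the vector is zero).
[cite: Balaban1984PropagatorsI, Sect. A p.17] -/
theorem eq_of_inBox_of_add_pmul {x y : Fin d → ℤ} (hx : InBox P x) (hy : InBox P y) {v w : Fin d → ℤ}
    (he : x + pmul P v = y + pmul P w) : v = w ∧ x = y := by
  have hv : v = w := by
    funext μ
    have e := congrFun he μ
    simp only [Pi.add_apply, pmul] at e
    obtain ⟨hx0, hx1⟩ := hx μ
    obtain ⟨hy0, hy1⟩ := hy μ
    have hP : (0 : ℤ) < P μ := by linarith
    rcases lt_trichotomy (v μ) (w μ) with hlt | heq | hgt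
    · have h2 : (P μ : ℤ) * (v μ + 1) ≤ (P μ : ℤ) * w μ := mul_le_mul_of_nonneg_left (by omega) hP.le
      nlinarith
    · exact heq
    · have h2 : (P μ : ℤ) * (w μ + 1) ≤ (P μ : ℤ) * v μ := mul_le_mul_of_nonneg_left (by omega) hP.le
      nlinarith
  subst hv
  exact ⟨rfl, add_right_cancel he⟩

/-- **Distinct torus sites lie in distinct orbits**: if deck translates of two torus sites coincide, the sites coincide (the
corner determines the cube-site for nested `Z″`, `M₁ ≥ 1`, `L ≥ 1`). [cite: Balaban1984PropagatorsI, Sect. A p.17; Balaban1984PropagatorsII, (2.45) p.231] -/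
theorem eq_of_shift_eq (hmono : Monotone Z) (hM₁ : 0 < M₁) (hL : 0 < L) {a b : TSite M₁ L Z P} {v w : Fin d → ℤ}
    (he : shift h v a.1 = shift h w b.1) : a = b := by
  have hc := congrArg cornerC he
  rw [cornerC_shift, cornerC_shift] at hc
  exact Subtype.ext (cornerC_injective hmono hM₁ hL (eq_of_inBox_of_add_pmul a.2 b.2 hc).2)

/-- **THE CONTOUR GRAPH OF THE TORUS** (print's admissible bonds (2.46) ON `T_η`, reading R0, with wrap-around): two distinct
torus sites are joined when a lift of one is joined in the cover to SOME lift of the other — the quotient of `latC` by the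
deck group. [cite: Balaban1984PropagatorsII, (2.46) p.231, (2.1) p.224; Balaban1984PropagatorsI, Sect. A p.17] -/
def torC (h : IsPeriodic M₁ L Z P) : SimpleGraph (TSite M₁ L Z P) :=
  SimpleGraph.fromRel fun a b => ∃ v : Fin d → ℤ, (latC M₁ L Z).Adj a.1 (shift h v b.1)

/-- Unfolding of the torus adjacency (the symmetrisation of `fromRel` is absorbed by the inverse translation).
[cite: Balaban1984PropagatorsII, (2.46) p.231] -/
theorem torC_adj {a b : TSite M₁ L Z P} :
    (torC h).Adj a b ↔ a ≠ b ∧ ∃ v : Fin d → ℤ, (latC M₁ L Z).Adj a.1 (shift h v b.1) := by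
  rw [torC, SimpleGraph.fromRel_adj]
  refine ⟨fun ⟨hne, hab⟩ => ⟨hne, hab.elim id fun ⟨v, hv⟩ => ⟨-v, ?_⟩⟩, fun ⟨hne, hab⟩ => ⟨hne, Or.inl hab⟩⟩
  have := latC_adj_shift (h := h) (-v) hv
  rw [shift_neg_shift] at this
  exact this.symm

/-- **A bond of the cover projects to a bond of the torus** (or to a point, when it joins two lifts of the same torus site).
[cite: Balaban1984PropagatorsII, (2.46) p.231] -/
theorem torC_adj_proj {s t : CubeSite M₁ L Z} (hst : (latC M₁ L Z).Adj s t) (hne : proj h s ≠ proj h t) :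
    (torC h).Adj (proj h s) (proj h t) := by
  refine torC_adj.mpr ⟨hne, ⟨redV P (cornerC s) - redV P (cornerC t), ?_⟩⟩
  have e : shift h (redV P (cornerC s) - redV P (cornerC t)) (proj h t).1 = shift h (redV P (cornerC s)) t := by
    rw [proj_val, ← shift_add, sub_add_cancel]
  rw [e, proj_val]
  exact latC_adj_shift _ hst

/-- **PROJECTION OF CONTOURS**: a contour of the cover from `s` to `t` projects to a contour of the torus from `proj s` to
`proj t` with at most as many bonds. [cite: Balaban1984PropagatorsII, (2.46) p.231] -/
theorem exists_walk_proj {s t : CubeSite M₁ L Z} (p : (latC M₁ L Z).Walk s t) :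
    ∃ q : (torC h).Walk (proj h s) (proj h t), q.length ≤ p.length := by
  induction p with
  | nil => exact ⟨SimpleGraph.Walk.nil, le_rfl⟩
  | @cons a b c hab p ih =>
    obtain ⟨q, hq⟩ := ih
    by_cases heq : proj h a = proj h b
    · exact ⟨q.copy heq.symm rfl, by rw [SimpleGraph.Walk.length_copy, SimpleGraph.Walk.length_cons]; omega⟩
    · exact ⟨SimpleGraph.Walk.cons (torC_adj_proj hab heq) q, by
        rw [SimpleGraph.Walk.length_cons, SimpleGraph.Walk.length_cons]; omega⟩

/-- **LIFTING OF CONTOURS**: a contour of the torus from `a` to `b` lifts to a contour of the cover from the lift `a` to SOME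
lift of `b`, with the same number of bonds. [cite: Balaban1984PropagatorsII, (2.46) p.231] -/
theorem exists_walk_lift {a b : TSite M₁ L Z P} (q : (torC h).Walk a b) :
    ∃ (v : Fin d → ℤ) (p : (latC M₁ L Z).Walk a.1 (shift h v b.1)), p.length = q.length := by
  induction q with
  | nil => exact ⟨0, SimpleGraph.Walk.nil.copy rfl (shift_zero _).symm, by simp⟩
  | @cons a c b hac q ih =>
    obtain ⟨v₁, hv₁⟩ := (torC_adj.mp hac).2
    obtain ⟨v₂, p, hp⟩ := ih
    refine ⟨v₁ + v₂, SimpleGraph.Walk.cons hv₁ ((p.map (shiftHom h v₁)).copy rfl ?_), ?_⟩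
    · rw [shiftHom_apply, shift_add]
    · rw [SimpleGraph.Walk.length_cons, SimpleGraph.Walk.length_copy, SimpleGraph.Walk.length_map, hp,
        SimpleGraph.Walk.length_cons]

/-- **The torus distance is at most the cover distance to any lift** (project a shortest contour of the cover; admissible
contours exist in the cover). [cite: Balaban1984PropagatorsII, (2.46) p.231] -/
theorem torC_dist_le_lift (hconn : (latC M₁ L Z).Connected) (a b : TSite M₁ L Z P) (v : Fin d → ℤ) :
    (torC h).dist a b ≤ (latC M₁ L Z).dist a.1 (shift h v b.1) := by
  obtain ⟨p, hp⟩ := hconn.exists_walk_length_eq_dist a.1 (shift h v b.1)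
  obtain ⟨q, hq⟩ := exists_walk_proj (h := h) p
  calc (torC h).dist a b ≤ (q.copy (proj_coe a) (by rw [proj_shift, proj_coe])).length := SimpleGraph.dist_le _
    _ = q.length := SimpleGraph.Walk.length_copy _ _ _
    _ ≤ p.length := hq
    _ = _ := hp

/-- Admissible contours exist on the torus: `torC` is connected when `latC` is. [cite: Balaban1984PropagatorsII, (2.46) p.231, (2.4) p.224] -/
theorem torC_connected (hconn : (latC M₁ L Z).Connected) : (torC h).Connected := by
  obtain ⟨s⟩ := hconn.nonempty
  haveI : Nonempty (TSite M₁ L Z P) := ⟨proj h s⟩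
  refine SimpleGraph.Connected.mk fun a b => ?_
  obtain ⟨p⟩ := hconn a.1 b.1
  obtain ⟨q, -⟩ := exists_walk_proj (h := h) p
  rw [proj_coe, proj_coe] at q
  exact ⟨q⟩

/-- **THE TORUS DISTANCE (2.46) IS THE LEAST COVER DISTANCE OVER THE LIFTS** — attained: for every pair of torus sites there
is a lift of the second whose cover distance from the (chosen lift of the) first IS the torus distance (lift a shortest torus
contour; compare with the projection bound). [cite: Balaban1984PropagatorsII, (2.46) p.231; Balaban1984PropagatorsI, Sect. A p.17] -/
theorem exists_lift_dist_eq (hconn : (latC M₁ L Z).Connected) (a b : TSite M₁ L Z P) :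
    ∃ v : Fin d → ℤ, (latC M₁ L Z).dist a.1 (shift h v b.1) = (torC h).dist a b := by
  obtain ⟨q, hq⟩ := (torC_connected (h := h) hconn).exists_walk_length_eq_dist a b
  obtain ⟨v, p, hp⟩ := exists_walk_lift q
  refine ⟨v, le_antisymm ?_ (torC_dist_le_lift hconn a b v)⟩
  calc (latC M₁ L Z).dist a.1 (shift h v b.1) ≤ p.length := SimpleGraph.dist_le p
    _ = (torC h).dist a b := by rw [hp, hq]

/-- The scale of a torus site. [cite: Balaban1984PropagatorsII, (2.45) p.231] -/
abbrev zoneT (a : TSite M₁ L Z P) : ℕ := zoneC a.1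

/-- **`Separates` ON THE TORUS** (joined torus cubes have equal or consecutive scales), transferred from the cover.
[cite: Balaban1984PropagatorsII, p.231] -/
theorem separates_torC (hs : Separates (latC M₁ L Z) zoneC) : Separates (torC h) (zoneT (P := P)) := by
  intro a b hab
  obtain ⟨-, v, hv⟩ := torC_adj.mp hab
  have := hs hv
  simpa [zoneT, zoneC_shift] using this

/-- **THE WALK FORM OF (2.2)/(2.57) ON THE TORUS**: `LevelGap (torC) zone N` from `LevelGap (latC) zone N` — a torus contour
crossing a collar lifts to a cover contour with the same number of bonds between sites of the same scales.
[cite: Balaban1984PropagatorsII, (2.2) p.224, (2.57) p.233; Balaban1989LargeFieldI, p.179] -/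
theorem levelGap_torC {N : ℕ} (hg : LevelGap (latC M₁ L Z) zoneC N) : LevelGap (torC h) (zoneT (P := P)) N := by
  intro i a b ha hb q
  obtain ⟨v, p, hp⟩ := exists_walk_lift q
  have := hg (i := i) (u := a.1) (x := shift h v b.1) ha (by simpa [zoneC_shift] using hb) p
  omega

/-- **THE GEOMETRIC INPUT OF [IV] (1.47) ON THE TORUS**: every torus contour from a cube of scale `≤ i` to a cube of scale
`≥ j + 1` has at least `(M/M₁)·(j − i)` bonds (nested periodic `Z″`, one separating layer, `M₁ ≥ 1`, `L ≥ 2`; the cover's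
`B15Ineq147LevelGap.length_ge_mul_of_levelGap` on the transferred walk form). [cite: Balaban1989LargeFieldI, (1.47) p.186, p.179; Balaban1984PropagatorsII, (2.57) p.233] -/
theorem walk_length_ge_torC {M : ℕ} (hmono : Monotone Z) (hsep : LayerSepZd Z M L) (hM₁ : 0 < M₁) (hL : 2 ≤ L)
    {i j : ℕ} {a b : TSite M₁ L Z P} (q : (torC h).Walk a b) (ha : zoneT a ≤ i) (hb : j + 1 ≤ zoneT b) :
    M / M₁ * (j - i) ≤ q.length :=
  length_ge_mul_of_levelGap (levelGap_torC (levelGap_latC hmono hsep hM₁ hL)) q ha hb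

/-- **THE TORUS DISTANCE AS A MINIMUM OVER THE LIFTS**, in closed form: `d_T(a, b) = min_{v ∈ ℤᵈ} d_{ℤᵈ}(a, v·b)` (admissible
contours existing in the cover). [cite: Balaban1984PropagatorsII, (2.46) p.231; Balaban1984PropagatorsI, Sect. A p.17] -/
theorem torC_dist_eq_iInf (hconn : (latC M₁ L Z).Connected) (a b : TSite M₁ L Z P) :
    (torC h).dist a b = ⨅ v : Fin d → ℤ, (latC M₁ L Z).dist a.1 (shift h v b.1) := by
  refine le_antisymm (le_ciInf fun v => torC_dist_le_lift hconn a b v) ?_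
  obtain ⟨v, hv⟩ := exists_lift_dist_eq (h := h) hconn a b
  rw [← hv]
  exact ciInf_le' _ v

/-! ## §3 The torus geometry, (2.61″) ON THE TORUS by orbit-injective lifting into the cover's row sum, and Lemma 2.1 -/

section Geo

/-- **THE LATTICE-CONTOUR GEOMETRY OF THE TORUS** on a finite set `F` of torus cube-sites: `𝔅 = F`, scale = the scale of the
cube, distance = print's (2.46) ON `T` read literally (R0: the least number of bonds of the torus contour graph `torC`,
wrap-around allowed, contours may leave `F`), parameters as given; the localisation vocabulary of Props. 2.2–2.8 is not used
by Lemma 2.1 and is filled trivially (as in `B15LatticeCubeContours.latGeo`, the cover's sibling).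
[cite: Balaban1984PropagatorsII, (2.1)–(2.4) p.224, (2.45)–(2.46) p.231; Balaban1984PropagatorsI, Sect. A p.17; Balaban1989LargeFieldI, p.179, p.186] -/
@[reducible] noncomputable def torGeo (h : IsPeriodic M₁ L Z P) (F : Finset (TSite M₁ L Z P)) (kk : ℕ) (η R Mr : ℝ) :
    B6.Geometry where
  Site := ↥F
  fin := inferInstance
  scale := fun y => zoneT y.1
  dist := fun y y' => ((torC h).dist y.1 y'.1 : ℝ)
  k := kk
  eta := η
  L := L
  R := R
  M := Mr
  Hyp21_22 := True
  Loc := PUnit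
  suppIn := fun _ _ => True
  supNorm := fun _ => 0
  l2Norm := fun _ => 0
  holder := fun _ _ => 0
  Cut := PUnit
  cutIn := fun _ _ => True
  cutH := fun _ _ => 0
  cutSup := fun _ => 0

variable (h : IsPeriodic M₁ L Z P) (F : Finset (TSite M₁ L Z P)) (kk : ℕ) (η R Mr : ℝ)

/-- The torus contour system of `torGeo` (all torus cube-sites, bonds `torC`, the inclusion of `F`, zones = scales).
[cite: Balaban1984PropagatorsII, (2.45)–(2.46) p.231] -/
@[reducible] def torSystem : ContourSystem (torGeo h F kk η R Mr) :=
  ⟨TSite M₁ L Z P, torC h, Subtype.val, zoneT, fun _ => rfl⟩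

/-- Its distance IS (2.46) of the torus contour system (by construction). [cite: Balaban1984PropagatorsII, (2.46) p.231] -/
theorem realizes_torGeo : Realizes (torGeo h F kk η R Mr) (torSystem h F kk η R Mr) := fun _ _ => rfl

/-- The auxiliary ROW geometry of the transfer: the sites of `F` LIFTED into the cover by a map `ι`, with the cover's contour
distance between the lifts. [cite: Balaban1984PropagatorsII, (2.46) p.231] -/
@[reducible] noncomputable def liftGeo (F : Finset (TSite M₁ L Z P)) (ι : ↥F → CubeSite M₁ L Z) (kk : ℕ) (η R Mr : ℝ) :
    B6.Geometry where
  Site := ↥F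
  fin := inferInstance
  scale := fun y => zoneT y.1
  dist := fun y y' => ((latC M₁ L Z).dist (ι y) (ι y') : ℝ)
  k := kk
  eta := η
  L := L
  R := R
  M := Mr
  Hyp21_22 := True
  Loc := PUnit
  suppIn := fun _ _ => True
  supNorm := fun _ => 0
  l2Norm := fun _ => 0
  holder := fun _ _ => 0
  Cut := PUnit
  cutIn := fun _ _ => True
  cutH := fun _ _ => 0
  cutSup := fun _ => 0

variable {F kk η R Mr} {M : ℕ}

/-- **(2.60) ON THE TORUS** (kernel-derived from the transferred walk form of (2.2): `B6Geometry.ineq260_of_levelGap`), for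
every `α, δ₀` with `αδ₀ ≥ 0`, `RM ≤ M/M₁`. [cite: Balaban1984PropagatorsII, (2.60) p.234, (2.2) p.224, (2.57) p.233; Balaban1989LargeFieldI, p.179] -/
theorem ineq260_torGeo (hmono : Monotone Z) (hsep : LayerSepZd Z M L) (ht : Tiles M₁ L Z) (hM₁ : 0 < M₁) (hM : M₁ ≤ M)
    (hL : 2 ≤ L) (hRM : R * Mr ≤ ((M / M₁ : ℕ) : ℝ)) {δ₀ α : ℝ} (hαδ : 0 ≤ α * δ₀) :
    B6RandomWalk.Ineq260 (torGeo h F kk η R Mr) δ₀ α :=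
  ineq260_of_levelGap (realizes_torGeo h F kk η R Mr) (torC_connected (latC_connected hmono hsep ht hM₁ hM hL))
    (levelGap_torC (levelGap_latC hmono hsep hM₁ hL)) hRM hαδ

/-- **(2.54) ON THE TORUS**: the triangle inequality of the torus contour distance. [cite: Balaban1984PropagatorsII, (2.54) p.233] -/
theorem triangle254_torGeo (hmono : Monotone Z) (hsep : LayerSepZd Z M L) (ht : Tiles M₁ L Z) (hM₁ : 0 < M₁) (hM : M₁ ≤ M)
    (hL : 2 ≤ L) : B6RandomWalk.Triangle254 (torGeo h F kk η R Mr) :=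
  triangle254_of_realizes (realizes_torGeo h F kk η R Mr) (torC_connected (latC_connected hmono hsep ht hM₁ hM hL))

variable [NeZero d]

/-- **(2.61″) ON THE TORUS WITH c₁″ = 13c₀(½α)^{4d}** — `Ineq261With (c1TwoScale d δ₀ α) (torGeo …) δ₀ α` under (2.59), for
print's distance (2.46) read literally on `T` (wrap-around contours), nested P-periodic `Z″` with one separating layer and the
covering (2.4), `1 ≤ M₁ ≤ M`, `L ≥ 2`, `RM ≤ M/M₁`, `2 ≤ M/M₁`.  PROOF = TRANSFER, nothing re-derived: fix the row `y`; for every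
torus site `y′` choose a lift `ι y′` whose COVER distance from the lift `y` equals the TORUS distance (`exists_lift_dist_eq`);
distinct torus sites have distinct lifts (`eq_of_shift_eq`), so the torus row at `y` IS a row of the cover geometry
`liftGeo F ι` — bounded by `B15LatticeCubeContours.sum_exp_le_latC`. [cite: Balaban1984PropagatorsII, Lemma 2.1 (2.61) p.234, (2.46) p.231, (2.1) p.224; Balaban1984PropagatorsI, Sect. A p.17; Balaban1989LargeFieldI, p.179, p.186; corrected] -/
theorem ineq261T_torGeo (hmono : Monotone Z) (hsep : LayerSepZd Z M L) (ht : Tiles M₁ L Z) (hM₁ : 0 < M₁) (hM : M₁ ≤ M)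
    (hL : 2 ≤ L) (hRM : R * Mr ≤ ((M / M₁ : ℕ) : ℝ)) (hN : 2 ≤ M / M₁) {δ₀ α : ℝ} (hα : 0 < α) (hδ : 0 < δ₀)
    (h259 : B6.Cond259 d δ₀ α R Mr) :
    B6Lemma21Repaired.Ineq261With (B6Lemma21TwoScale.c1TwoScale d δ₀ α) (torGeo h F kk η R Mr) δ₀ α := by
  intro y
  have hconn := latC_connected hmono hsep ht hM₁ hM hL
  choose v hv using fun b : ↥F => exists_lift_dist_eq (h := h) hconn y.1 b.1
  set ι : ↥F → CubeSite M₁ L Z := fun b => shift h (v b) b.1.1 with hιdef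
  have hιy : ι y = y.1.1 := by
    have h0 : (latC M₁ L Z).dist y.1.1 (ι y) = 0 := by
      rw [hιdef]
      simp only
      rw [hv y, SimpleGraph.dist_self]
    exact ((hconn.dist_eq_zero_iff).mp h0).symm
  have hι : Function.Injective ι := fun b c hbc => Subtype.ext (eq_of_shift_eq (h := h) hmono hM₁ (by omega) hbc)
  have hrow := sum_exp_le_latC (g := liftGeo F ι kk η R Mr) ι hι (fun _ => rfl) (fun _ _ => rfl) hmono hsep ht hM₁ hM hL
    hRM hN hα hδ h259 y
  calc ∑ y' : ↥F, Real.exp (-(α * δ₀ * (((torC h).dist y.1 y'.1 : ℕ) : ℝ)))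
      = ∑ y' : ↥F, Real.exp (-(α * δ₀ * (((latC M₁ L Z).dist (ι y) (ι y') : ℕ) : ℝ))) := by
        refine Finset.sum_congr rfl fun y' _ => ?_
        rw [hιy, hιdef]
        simp only
        rw [hv y']
    _ ≤ 13 * B6.c0 δ₀ (α / 2) ^ (4 * d) := hrow

/-- **LEMMA 2.1 (TWO-SCALE CONSTANT) ON THE TORUS**: `B6Lemma21TwoScale.Lemma21TwoScale d δ₀ (torGeo …)` — (2.60) ∧ (2.61″)
for every 0 < α < 1 under (2.59), via `lemma21TwoScale_of_ineq261T` with every graph-theoretic hypothesis (realisation,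
connectedness, `LevelGap (M/M₁)`) DISCHARGED on the torus. [cite: Balaban1984PropagatorsII, Lemma 2.1 (2.60)–(2.61) p.234; Balaban1984PropagatorsI, Sect. A p.17; Balaban1989LargeFieldI, p.179; corrected] -/
theorem lemma21TwoScale_torGeo (hmono : Monotone Z) (hsep : LayerSepZd Z M L) (ht : Tiles M₁ L Z) (hM₁ : 0 < M₁)
    (hM : M₁ ≤ M) (hL : 2 ≤ L) (hRM : R * Mr ≤ ((M / M₁ : ℕ) : ℝ)) (hN : 2 ≤ M / M₁) {δ₀ : ℝ} (hδ : 0 < δ₀) :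
    B6Lemma21TwoScale.Lemma21TwoScale d δ₀ (fun _ : PUnit => torGeo h F kk η R Mr) :=
  B6Lemma21TwoScale.lemma21TwoScale_of_ineq261T d δ₀ hδ.le _ (fun _ => torSystem h F kk η R Mr) (fun _ => M / M₁)
    (fun _ => realizes_torGeo h F kk η R Mr) (fun _ => torC_connected (latC_connected hmono hsep ht hM₁ hM hL))
    (fun _ => levelGap_torC (levelGap_latC hmono hsep hM₁ hL)) (fun _ => hRM)
    fun _ _ _ hα0 _ h259 => ineq261T_torGeo h hmono hsep ht hM₁ hM hL hRM hN hα0 hδ h259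

/-- **ALL FOUR DISPLAYS (2.60)–(2.63) OF LEMMA 2.1 WITH c₁″ ON THE TORUS CUBE CARRIER** (0 < α < 1, (2.59)) — print's own
setting *«Ω_j ⊂ T_η»* with wrap-around contours; the B6-CLOSURE item «torus wrap-around for the R0 Lemma 2.1».
[cite: Balaban1984PropagatorsII, Lemma 2.1 (2.60)–(2.63) p.234, (2.1) p.224; Balaban1984PropagatorsI, Sect. A p.17; corrected] -/
theorem lemma21_full_torGeo (hmono : Monotone Z) (hsep : LayerSepZd Z M L) (ht : Tiles M₁ L Z) (hM₁ : 0 < M₁)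
    (hM : M₁ ≤ M) (hL : 2 ≤ L) (hRM : R * Mr ≤ ((M / M₁ : ℕ) : ℝ)) (hN : 2 ≤ M / M₁) {δ₀ : ℝ} (hδ : 0 < δ₀) :
    ∀ α : ℝ, 0 < α → α < 1 → B6.Cond259 d δ₀ α R Mr →
      B6RandomWalk.Ineq260 (torGeo h F kk η R Mr) δ₀ α ∧
        B6Lemma21Repaired.Ineq261With (B6Lemma21TwoScale.c1TwoScale d δ₀ α) (torGeo h F kk η R Mr) δ₀ α ∧
        B6Lemma21Repaired.Ineq262With (B6Lemma21TwoScale.c1TwoScale d δ₀ α) (torGeo h F kk η R Mr) δ₀ α ∧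
        B6Lemma21Repaired.Ineq263With (B6Lemma21TwoScale.c1TwoScale d δ₀ α) (torGeo h F kk η R Mr) δ₀ α :=
  fun α hα0 hα1 h259 =>
    B6Lemma21TwoScale.lemma21TwoScale_full d δ₀ hδ.le _ (fun _ => triangle254_torGeo h hmono hsep ht hM₁ hM hL)
      (lemma21TwoScale_torGeo h hmono hsep ht hM₁ hM hL hRM hN hδ) PUnit.unit trivial α hα0 hα1 h259

/-- **THE ROW SUM AS A NUMBER** on the torus: `Σ_{y′∈𝔅} e^{−αδ₀d_T(y,y′)} ≤ 13c₀(½α)^{4d}` at every base point — independent of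
L, of the periods `P_μ` (the volume), of the number of scales and of the periodic family. [cite: Balaban1984PropagatorsII, (2.61) p.234; corrected] -/
theorem sum_exp_le_torC (hmono : Monotone Z) (hsep : LayerSepZd Z M L) (ht : Tiles M₁ L Z) (hM₁ : 0 < M₁) (hM : M₁ ≤ M)
    (hL : 2 ≤ L) (hRM : R * Mr ≤ ((M / M₁ : ℕ) : ℝ)) (hN : 2 ≤ M / M₁) {δ₀ α : ℝ} (hα : 0 < α) (hδ : 0 < δ₀)
    (h259 : B6.Cond259 d δ₀ α R Mr) (y : ↥F) :
    ∑ y' : ↥F, Real.exp (-(α * δ₀ * (torC h).dist y.1 y'.1)) ≤ 13 * B6.c0 δ₀ (α / 2) ^ (4 * d) :=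
  ineq261T_torGeo h (F := F) (kk := 0) (η := 0) hmono hsep ht hM₁ hM hL hRM hN hα hδ h259 y

end Geo

/-! ## §4 Families (the uniformity `DagBinding.B6Lemma21Param` asks for), all torus sites as 𝔅, and periodic admissible
sequences with finitely many scales -/

section Family

variable [NeZero d] {I : Type}

/-- **LEMMA 2.1 (TWO-SCALE CONSTANT) UNIFORMLY OVER ANY FAMILY OF TORUS CUBE GEOMETRIES**: ONE constant c₁″(α) for the whole
family (periods, `Z″`, site sets, numbers of scales, L, M₁, M, R, M_r may vary with the index) — the shape consumed by
`DagBinding.b6Lemma21Param_of_twoScale`; print's family index `I = (k, T_η)`. [cite: Balaban1984PropagatorsII, Lemma 2.1 (2.60)–(2.61) p.234; Balaban1984PropagatorsI, Sect. A p.17; corrected] -/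
theorem lemma21TwoScale_torGeo_family {δ₀ : ℝ} (hδ : 0 < δ₀) (M₁ L M : I → ℕ) (Z : I → ℕ → Set (Fin d → ℤ))
    (P : I → Fin d → ℕ) (h : ∀ i, IsPeriodic (M₁ i) (L i) (Z i) (P i)) (F : ∀ i, Finset (TSite (M₁ i) (L i) (Z i) (P i)))
    (kk : I → ℕ) (η R Mr : I → ℝ) (hmono : ∀ i, Monotone (Z i)) (hsep : ∀ i, LayerSepZd (Z i) (M i) (L i))
    (ht : ∀ i, Tiles (M₁ i) (L i) (Z i)) (hM₁ : ∀ i, 0 < M₁ i) (hM : ∀ i, M₁ i ≤ M i) (hL : ∀ i, 2 ≤ L i)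
    (hRM : ∀ i, R i * Mr i ≤ ((M i / M₁ i : ℕ) : ℝ)) (hN : ∀ i, 2 ≤ M i / M₁ i) :
    B6Lemma21TwoScale.Lemma21TwoScale d δ₀ (fun i => torGeo (h i) (F i) (kk i) (η i) (R i) (Mr i)) :=
  B6Lemma21TwoScale.lemma21TwoScale_of_ineq261T d δ₀ hδ.le _ (fun i => torSystem (h i) (F i) (kk i) (η i) (R i) (Mr i))
    (fun i => M i / M₁ i) (fun i => realizes_torGeo (h i) (F i) (kk i) (η i) (R i) (Mr i))
    (fun i => torC_connected (latC_connected (hmono i) (hsep i) (ht i) (hM₁ i) (hM i) (hL i)))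
    (fun i => levelGap_torC (levelGap_latC (hmono i) (hsep i) (hM₁ i) (hL i))) hRM
    fun i _ _ hα0 _ h259 => ineq261T_torGeo (h i) (hmono i) (hsep i) (ht i) (hM₁ i) (hM i) (hL i) (hRM i) (hN i) hα0 hδ h259

end Family

section AllSites

/-- **The torus has finitely many cube-sites** (nested `Z″`, `M₁ ≥ 1`, `L ≥ 1`): the corner, a point of the finite fundamental box,
determines the site — so `𝔅 = all cube-sites of T` is a legitimate (the printed) choice of `F`. [cite: Balaban1984PropagatorsII, (2.45) p.231, (2.4) p.224; Balaban1984PropagatorsI, Sect. A p.17] -/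
theorem finite_TSite (hmono : Monotone Z) (hM₁ : 0 < M₁) (hL : 0 < L) : Finite (TSite M₁ L Z P) := by
  classical
  let f : TSite M₁ L Z P → ((μ : Fin d) → Fin (P μ)) := fun a μ =>
    ⟨(cornerC a.1 μ).toNat, by
      have h0 := (a.2 μ).1
      have h1 := (a.2 μ).2
      omega⟩
  refine Finite.of_injective f fun a b hab => ?_
  apply Subtype.ext
  apply cornerC_injective hmono hM₁ hL
  funext μ
  have e := congrArg (fun g => ((g μ : Fin (P μ)) : ℕ)) hab
  simp only [f] at e
  have ha := (a.2 μ).1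
  have hb := (b.2 μ).1
  omega

end AllSites

section Periodic

/-- **PERIODICITY FROM THE PRINTED SHAPE**: a nested family that is invariant under the deck translations, all of whose members
from the index `K + 1` on are the whole lattice (finitely many scales `≤ K`, as on print's finite torus), with `M₁L^K` dividing
the periods, is `IsPeriodic` (`M₁ ≥ 1`, `L ≥ 1`: every cube of the model has scale `≤ K`). [cite: Balaban1984PropagatorsII, (2.1)–(2.4) p.224; Balaban1984PropagatorsI, Sect. A p.17; Balaban1989LargeFieldI, p.179] -/
theorem isPeriodic_of_top (hmono : Monotone Z) (hM₁ : 0 < M₁) (hL : 0 < L) (hP : ∀ μ, 0 < P μ)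
    (hper : ∀ (n : ℕ) (x v : Fin d → ℤ), x + pmul P v ∈ Z n ↔ x ∈ Z n) {K : ℕ} (hK : Z (K + 1) = Set.univ)
    (hdvd : ∀ μ, M₁ * L ^ K ∣ P μ) : IsPeriodic M₁ L Z P := by
  refine ⟨hP, hper, fun s μ => ?_⟩
  have hs : zoneC s ≤ K := by
    by_contra hlt
    have hsub : Z (K + 1) ⊆ Z s.1.1 := hmono (by unfold zoneC at hlt; omega)
    exact (corner_mem_layer hM₁ hL s).2 (hsub (by rw [hK]; trivial))
  exact (Nat.mul_dvd_mul_left M₁ (Nat.pow_dvd_pow L hs)).trans (hdvd μ)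

variable {M K : ℕ} {D : ℕ → Set (Fin d → ℤ)}

/-- **The periodicity datum of a periodic [III] (2.13)-admissible sequence with finitely many scales**, CONSTRUCTED: r11's
separation property `hdistD` on the cover, `Ω_{K+1} = ∅`, invariance of every `Ω_n` under the deck translations, positive
periods with `M₁L^K ∣ P_μ`, `M₁ ≥ 1`, `M ≥ 1`, `L ≥ 1`. [cite: Balaban1984PropagatorsII, (2.1)–(2.4) p.224; Balaban1988Convergent, (2.13) p.256; Balaban1984PropagatorsI, Sect. A p.17] -/
theorem isPeriodic_of_admissible
    (hdistD : ∀ n, ∀ x ∈ D (n + 1), ∀ y, Within ((B14.Eq213MaximalDomains.side L M (n + 1) : ℤ) - 1) x y → y ∈ D n)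
    (hK : D (K + 1) = ∅) (hperD : ∀ (n : ℕ) (x v : Fin d → ℤ), x + pmul P v ∈ D n ↔ x ∈ D n) (hP : ∀ μ, 0 < P μ)
    (hdvdP : ∀ μ, M₁ * L ^ K ∣ P μ) (hM₁ : 0 < M₁) (hMpos : 1 ≤ M) (hL : 1 ≤ L) :
    IsPeriodic M₁ L (fun n => (D n)ᶜ) P :=
  isPeriodic_of_top (monotone_compl_of_admissible hL hMpos hdistD) hM₁ (by omega) hP
    (fun n x v => by simp only [Set.mem_compl_iff, hperD]) (by simp [hK]) hdvdP

variable [NeZero d]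

/-- **LEMMA 2.1 (2.60)–(2.63) WITH c₁″ FOR PRINT'S DISTANCE (2.46) READ LITERALLY ON THE TORUS, OVER ANY PERIODIC [III]
(2.13)-ADMISSIBLE SEQUENCE OF DOMAINS WITH FINITELY MANY SCALES** (`Z″ = Ωᶜ` pulled back to the cover; the periodicity datum
`h` is `isPeriodic_of_admissible`): hypotheses = r11's admissibility data on the cover (`hdistD`, every `Ω_n` a union of
`LⁿM`-cubes), `Ω₀ = T`, `Ω_{K+1} = ∅`, and the numerics `1 ≤ M₁`, `M₁ ∣ M`, `L ≥ 2`, `R·M_r ≤ M/M₁`, `2 ≤ M/M₁`, `δ₀ > 0`,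
0 < α < 1, (2.59).  Compare the cover's `B15LatticeCubeContours.lemma21_full_latGeo_admissible`.
[cite: Balaban1984PropagatorsII, Lemma 2.1 (2.60)–(2.63) p.234, (2.1)–(2.4) p.224, (2.46) p.231; Balaban1988Convergent, (2.13) p.256; Balaban1984PropagatorsI, Sect. A p.17; Balaban1989LargeFieldI, p.179; corrected] -/
theorem lemma21_full_torGeo_admissible
    (hdistD : ∀ n, ∀ x ∈ D (n + 1), ∀ y, Within ((B14.Eq213MaximalDomains.side L M (n + 1) : ℤ) - 1) x y → y ∈ D n)
    (hcubes : ∀ n, IsUnionOfCubes (B14.Eq213MaximalDomains.side L M n) (D n)) (h0 : D 0 = Set.univ) (hK : D (K + 1) = ∅)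
    (hM₁ : 0 < M₁) (hMpos : 1 ≤ M) (hdvd : M₁ ∣ M) (hL : 2 ≤ L) (h : IsPeriodic M₁ L (fun n => (D n)ᶜ) P)
    (F : Finset (TSite M₁ L (fun n => (D n)ᶜ) P)) (kk : ℕ) (η R Mr : ℝ) (hRM : R * Mr ≤ ((M / M₁ : ℕ) : ℝ))
    (hN : 2 ≤ M / M₁) {δ₀ : ℝ} (hδ : 0 < δ₀) :
    ∀ α : ℝ, 0 < α → α < 1 → B6.Cond259 d δ₀ α R Mr →
      B6RandomWalk.Ineq260 (torGeo h F kk η R Mr) δ₀ α ∧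
        B6Lemma21Repaired.Ineq261With (B6Lemma21TwoScale.c1TwoScale d δ₀ α) (torGeo h F kk η R Mr) δ₀ α ∧
        B6Lemma21Repaired.Ineq262With (B6Lemma21TwoScale.c1TwoScale d δ₀ α) (torGeo h F kk η R Mr) δ₀ α ∧
        B6Lemma21Repaired.Ineq263With (B6Lemma21TwoScale.c1TwoScale d δ₀ α) (torGeo h F kk η R Mr) δ₀ α :=
  lemma21_full_torGeo h (monotone_compl_of_admissible (by omega) hMpos hdistD) (layerSepZd_of_admissible hdistD)
    (tiles_of_admissible hM₁ (by omega) hdvd hcubes h0 fun x => ⟨K + 1, by rw [hK]; exact fun hx => hx⟩) hM₁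
    (Nat.le_of_dvd hMpos hdvd) hL hRM hN hδ

end Periodic

/-! ## §5 Non-vacuity: a two-scale torus (a periodic array of coarse cells refined into finer cubes, wrap-around present) -/

section TwoScale

/-- The periodic array of COARSE CELLS: the scale-`K` cubes (side `M₁L^K`) whose index is divisible by `N` in every
coordinate — one cell per period cell of the torus of periods `P_μ = M₁L^K·N`. [cite: Balaban1984PropagatorsII, (2.1)–(2.4) p.224; Balaban1989LargeFieldI, p.179] -/
def cellA (M₁ L K N : ℕ) : Set (Fin d → ℤ) := {x | ∀ μ, (N : ℤ) ∣ cubeIdx (M₁ * L ^ K) x μ}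

/-- **A TWO-SCALE PERIODIC NESTED FAMILY**: `Z″_n = ∅` for `n < K`, `Z″_K = cellA` (the cells, tiled by scale-`(K−1)` cubes),
`Z″_n = ℤᵈ` for `n > K` (the rest of the torus, tiled by scale-`K` cubes) — the cover of a torus with `Nᵈ` coarse cubes one of
which is a large-field cell refined to the next scale. [cite: Balaban1984PropagatorsII, (2.1)–(2.4) p.224; Balaban1989LargeFieldI, p.179] -/
def twoScaleZ (M₁ L K N : ℕ) : ℕ → Set (Fin d → ℤ) := fun n =>
  if n < K then ∅ else if n = K then cellA M₁ L K N else Set.univ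

variable {K N : ℕ}

/-- Below the finer scale the family is empty. [cite: Balaban1984PropagatorsII, (2.1) p.224] -/
theorem twoScaleZ_of_lt {n : ℕ} (hn : n < K) : twoScaleZ (d := d) M₁ L K N n = ∅ := by
  simp [twoScaleZ, hn]

/-- At the index `K` it is the array of cells. [cite: Balaban1984PropagatorsII, (2.1) p.224] -/
theorem twoScaleZ_K : twoScaleZ (d := d) M₁ L K N K = cellA M₁ L K N := by
  simp [twoScaleZ]

/-- Above `K` it is everything (*«we admit the case when some domains Ω_j are equal to T_η»*). [cite: Balaban1984PropagatorsII, (2.1)–(2.4) p.224] -/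
theorem twoScaleZ_of_gt {n : ℕ} (hn : K < n) : twoScaleZ (d := d) M₁ L K N n = Set.univ := by
  simp [twoScaleZ, show ¬ n < K by omega, show n ≠ K by omega]

/-- The family is nested. [cite: Balaban1984PropagatorsII, (2.1) p.224] -/
theorem monotone_twoScaleZ : Monotone (twoScaleZ (d := d) M₁ L K N) := by
  intro m n hmn x hx
  rcases lt_trichotomy n K with h1 | h2 | h3
  · rw [twoScaleZ_of_lt (lt_of_le_of_lt hmn h1)] at hx
    exact hx.elim
  · subst h2
    rcases Nat.lt_or_ge m n with h4 | h4
    · rw [twoScaleZ_of_lt h4] at hx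
      exact hx.elim
    · rw [le_antisymm hmn h4] at hx
      exact hx
  · rw [twoScaleZ_of_gt h3]
    trivial

/-- With two scales the one-layer separation is void (it constrains pairs of NON-consecutive members only), for any `M`.
[cite: Balaban1989LargeFieldI, p.179] -/
theorem layerSepZd_twoScaleZ (M : ℕ) : LayerSepZd (twoScaleZ (d := d) M₁ L K N) M L := by
  intro n a b ha hb
  rcases Nat.lt_or_ge n K with h1 | h1
  · rw [twoScaleZ_of_lt h1] at ha
    exact ha.elim
  · refine (hb ?_).elim
    rw [twoScaleZ_of_gt (by omega)]
    trivial

/-- The array of cells is a union of scale-`K` cubes (by definition through the cube index). [cite: Balaban1989LargeFieldI, p.179] -/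
theorem isUnionOfCubes_cellA : IsUnionOfCubes (M₁ * L ^ K) (cellA (d := d) M₁ L K N) := by
  intro x y hxy
  simp only [cellA, Set.mem_setOf_eq, hxy]

/-- A union of `s·t`-cubes is a union of `s`-cubes (nested partitions; as in `B15LatticeCubeContours`). [folklore] -/
private theorem isUnionOfCubes_of_mul {s t : ℕ} {Λ : Set (Fin d → ℤ)} (hU : IsUnionOfCubes (s * t) Λ) :
    IsUnionOfCubes s Λ := by
  intro x y hxy
  apply hU
  funext i
  have hi := congrFun hxy i
  unfold cubeIdx at hi ⊢
  push_cast
  rw [← Int.ediv_ediv_of_nonneg (Int.natCast_nonneg s), ← Int.ediv_ediv_of_nonneg (Int.natCast_nonneg s), hi]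

/-- **The covering (2.4) for the two-scale family** (`M₁ ≥ 1`, `L ≥ 1`, `K ≥ 1`): cells are tiled by scale-`(K−1)` cubes, their
complement by scale-`K` cubes. [cite: Balaban1984PropagatorsII, (2.4) p.224; Balaban1989LargeFieldI, p.179] -/
theorem tiles_twoScaleZ (hM₁ : 0 < M₁) (hL : 0 < L) (hK : 1 ≤ K) : Tiles M₁ L (twoScaleZ (d := d) M₁ L K N) := by
  apply tiles_of_layers hM₁ hL
  · intro n
    rcases lt_trichotomy (n + 1) K with h1 | h2 | h3
    · rw [twoScaleZ_of_lt h1]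
      intro x y _
      simp
    · rw [h2, twoScaleZ_K, twoScaleZ_of_lt (by omega), Set.sdiff_empty]
      have e : M₁ * L ^ K = M₁ * L ^ n * L := by rw [← h2, pow_succ, mul_assoc]
      exact isUnionOfCubes_of_mul (e ▸ isUnionOfCubes_cellA)
    · rcases Nat.lt_or_ge K n with h4 | h4
      · rw [twoScaleZ_of_gt h3, twoScaleZ_of_gt h4]
        intro x y _
        simp
      · have hn : n = K := by omega
        subst hn
        rw [twoScaleZ_of_gt h3, twoScaleZ_K, ← Set.compl_eq_univ_sdiff]
        exact isUnionOfCubes_cellA.compl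
  · intro x
    by_cases hx : x ∈ cellA M₁ L K N
    · refine ⟨K - 1, ?_⟩
      rw [show K - 1 + 1 = K by omega, twoScaleZ_K, twoScaleZ_of_lt (by omega)]
      exact ⟨hx, fun h0 => h0⟩
    · refine ⟨K, ?_⟩
      rw [twoScaleZ_of_gt (by omega), twoScaleZ_K]
      exact ⟨trivial, hx⟩

/-- The array of cells is invariant under the deck translations of the torus of periods `M₁L^K·N`.
[cite: Balaban1984PropagatorsI, Sect. A p.17; Balaban1984PropagatorsII, (2.1) p.224] -/
theorem cellA_periodic (hM₁ : 0 < M₁) (hL : 0 < L) (x v : Fin d → ℤ) :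
    x + pmul (fun _ => M₁ * L ^ K * N) v ∈ cellA (d := d) M₁ L K N ↔ x ∈ cellA M₁ L K N := by
  have hS : (0 : ℤ) < ((M₁ * L ^ K : ℕ) : ℤ) := by exact_mod_cast Nat.mul_pos hM₁ (Nat.pow_pos hL)
  simp only [cellA, Set.mem_setOf_eq]
  refine forall_congr' fun μ => ?_
  have e : cubeIdx (M₁ * L ^ K) (x + pmul (fun _ => M₁ * L ^ K * N) v) μ = cubeIdx (M₁ * L ^ K) x μ + (N : ℤ) * v μ := by
    have hc : ((M₁ * L ^ K * N : ℕ) : ℤ) = ((M₁ * L ^ K : ℕ) : ℤ) * (N : ℤ) := by push_cast; ring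
    unfold cubeIdx
    simp only [Pi.add_apply, pmul_apply]
    rw [hc, mul_assoc, Int.add_mul_ediv_left _ _ hS.ne']
  rw [e]
  exact dvd_add_left (dvd_mul_right (N : ℤ) (v μ))

/-- **THE TWO-SCALE FAMILY IS PERIODIC** for the periods `P_μ = M₁L^K·N` (`M₁, L, N ≥ 1`). [cite: Balaban1984PropagatorsII, (2.1)–(2.4) p.224; Balaban1984PropagatorsI, Sect. A p.17] -/
theorem isPeriodic_twoScaleZ (hM₁ : 0 < M₁) (hL : 0 < L) (hN : 0 < N) :
    IsPeriodic M₁ L (twoScaleZ (d := d) M₁ L K N) (fun _ => M₁ * L ^ K * N) :=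
  isPeriodic_of_top (K := K) monotone_twoScaleZ hM₁ hL (fun _ => Nat.mul_pos (Nat.mul_pos hM₁ (Nat.pow_pos hL)) hN)
    (fun n x v => by
      rcases lt_trichotomy n K with h1 | h2 | h3
      · simp [twoScaleZ_of_lt h1]
      · subst h2
        rw [twoScaleZ_K]
        exact cellA_periodic hM₁ hL x v
      · simp [twoScaleZ_of_gt h3])
    (twoScaleZ_of_gt (Nat.lt_succ_self K)) fun _ => dvd_mul_right (M₁ * L ^ K) N

/-- **LEMMA 2.1 (2.60)–(2.63) WITH c₁″ ON THE TWO-SCALE TORUS — NUMERICS ONLY** (`d ≥ 1`, `M₁ ≥ 1`, `L ≥ 2`, `K ≥ 1`, `N ≥ 1`,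
an integer `N_r ≥ 2` with `R·M_r ≤ N_r`, `δ₀ > 0`, 0 < α < 1, (2.59)): every hypothesis of `lemma21_full_torGeo` discharged
on a named periodic family — the torus statement is inhabited (wrap-around contours between the `Nᵈ` coarse cubes and the
`Lᵈ` finer cubes of the refined cell). [cite: Balaban1984PropagatorsII, Lemma 2.1 (2.60)–(2.63) p.234, (2.1)–(2.4) p.224; Balaban1984PropagatorsI, Sect. A p.17; corrected] -/
theorem lemma21_full_torGeo_twoScale [NeZero d] (hM₁ : 0 < M₁) (hL : 2 ≤ L) (hK : 1 ≤ K) (hN : 0 < N) {Nr : ℕ}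
    (hNr : 2 ≤ Nr) (F : Finset (TSite M₁ L (twoScaleZ (d := d) M₁ L K N) (fun _ => M₁ * L ^ K * N))) (kk : ℕ)
    (η R Mr : ℝ) (hRM : R * Mr ≤ (Nr : ℝ)) {δ₀ : ℝ} (hδ : 0 < δ₀) :
    ∀ α : ℝ, 0 < α → α < 1 → B6.Cond259 d δ₀ α R Mr →
      B6RandomWalk.Ineq260 (torGeo (isPeriodic_twoScaleZ hM₁ (by omega) hN) F kk η R Mr) δ₀ α ∧
        B6Lemma21Repaired.Ineq261With (B6Lemma21TwoScale.c1TwoScale d δ₀ α)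
          (torGeo (isPeriodic_twoScaleZ hM₁ (by omega) hN) F kk η R Mr) δ₀ α ∧
        B6Lemma21Repaired.Ineq262With (B6Lemma21TwoScale.c1TwoScale d δ₀ α)
          (torGeo (isPeriodic_twoScaleZ hM₁ (by omega) hN) F kk η R Mr) δ₀ α ∧
        B6Lemma21Repaired.Ineq263With (B6Lemma21TwoScale.c1TwoScale d δ₀ α)
          (torGeo (isPeriodic_twoScaleZ hM₁ (by omega) hN) F kk η R Mr) δ₀ α := by
  have hdiv : M₁ * Nr / M₁ = Nr := Nat.mul_div_cancel_left Nr hM₁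
  refine lemma21_full_torGeo _ (M := M₁ * Nr) monotone_twoScaleZ (layerSepZd_twoScaleZ _)
    (tiles_twoScaleZ hM₁ (by omega) hK) hM₁ (Nat.le_mul_of_pos_right M₁ (by omega)) hL ?_ ?_ hδ
  · rw [hdiv]; exact hRM
  · rw [hdiv]; exact hNr

end TwoScale

/-! ## §6 (v1.1, append-only) PERIODIZATION: every [III]-admissible configuration of the cover with finitely many scales,
repeated over the period cells, is the pull-back of a torus configuration — so the torus Lemma 2.1 consumes r11's
(non-periodic) admissible sequences directly -/

section Periodize

/-- **The periodization** of a family of sets of the cover: the union of all deck translates (the pull-back to ℤᵈ of the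
image in `T = ℤᵈ/∏P_μℤ`). [cite: Balaban1984PropagatorsI, Sect. A p.17; Balaban1984PropagatorsII, (2.1) p.224] -/
def periodize (P : Fin d → ℕ) (D : ℕ → Set (Fin d → ℤ)) : ℕ → Set (Fin d → ℤ) :=
  fun n => {x | ∃ v : Fin d → ℤ, x - pmul P v ∈ D n}

variable {D : ℕ → Set (Fin d → ℤ)}

/-- The trivial translation vector. [folklore] -/
@[simp] private theorem pmul_zero (P : Fin d → ℕ) : pmul P (0 : Fin d → ℤ) = 0 := by
  funext μ; simp [pmul]

/-- A set is contained in its periodization. [cite: Balaban1984PropagatorsI, Sect. A p.17] -/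
theorem subset_periodize (n : ℕ) : D n ⊆ periodize P D n := fun x hx =>
  ⟨0, by rw [pmul_zero, sub_zero]; exact hx⟩

/-- **The periodization is invariant under the deck translations.** [cite: Balaban1984PropagatorsI, Sect. A p.17] -/
theorem periodize_mem_iff (n : ℕ) (x v : Fin d → ℤ) : x + pmul P v ∈ periodize P D n ↔ x ∈ periodize P D n := by
  constructor
  · rintro ⟨w, hw⟩
    refine ⟨w - v, ?_⟩
    convert hw using 1
    funext μ
    simp only [Pi.sub_apply, Pi.add_apply, pmul]
    ring
  · rintro ⟨w, hw⟩
    refine ⟨w + v, ?_⟩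
    convert hw using 1
    funext μ
    simp only [Pi.sub_apply, Pi.add_apply, pmul]
    ring

/-- The periodization of the whole lattice is the whole lattice. [cite: Balaban1984PropagatorsII, (2.1)–(2.4) p.224] -/
theorem periodize_univ {n : ℕ} (hn : D n = Set.univ) : periodize P D n = Set.univ :=
  Set.eq_univ_of_forall fun _ => ⟨0, by rw [hn]; trivial⟩

/-- The periodization of the empty set is empty. [cite: Balaban1984PropagatorsII, (2.1)–(2.4) p.224] -/
theorem periodize_empty {n : ℕ} (hn : D n = ∅) : periodize P D n = ∅ :=
  Set.subset_empty_iff.mp fun _ ⟨_, hv⟩ => by rw [hn] at hv; exact hv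

/-- `Within` is translation invariant. [folklore] -/
private theorem within_sub_iff {r : ℤ} {x y t : Fin d → ℤ} : Within r (x - t) (y - t) ↔ Within r x y := by
  simp only [Within, Pi.sub_apply, sub_sub_sub_cancel_right]

/-- **r11's separation property (2.13) survives periodization** (it is a translation-invariant local statement).
[cite: Balaban1988Convergent, (2.13) p.256; Balaban1984PropagatorsI, Sect. A p.17] -/
theorem hdistD_periodize {L M : ℕ}
    (hdist : ∀ n, ∀ x ∈ D (n + 1), ∀ y, Within ((B14.Eq213MaximalDomains.side L M (n + 1) : ℤ) - 1) x y → y ∈ D n) :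
    ∀ n, ∀ x ∈ periodize P D (n + 1), ∀ y,
      Within ((B14.Eq213MaximalDomains.side L M (n + 1) : ℤ) - 1) x y → y ∈ periodize P D n := by
  rintro n x ⟨v, hv⟩ y hxy
  exact ⟨v, hdist n _ hv _ (within_sub_iff.mpr hxy)⟩

/-- The cube index of a deck translate (cube side `s ∣ P_μ`). [cite: Balaban1989LargeFieldI, p.186] -/
theorem cubeIdx_sub_pmul {s : ℕ} (hs : ∀ μ, s ∣ P μ) (hs0 : 0 < s) (x v : Fin d → ℤ) (μ : Fin d) :
    cubeIdx s (x - pmul P v) μ = cubeIdx s x μ - ((P μ / s : ℕ) : ℤ) * v μ := by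
  have hs' : (s : ℤ) ≠ 0 := by exact_mod_cast hs0.ne'
  have hc : (P μ : ℤ) = (s : ℤ) * ((P μ / s : ℕ) : ℤ) := by exact_mod_cast (Nat.mul_div_cancel' (hs μ)).symm
  unfold cubeIdx
  simp only [Pi.sub_apply, pmul_apply]
  rw [hc, show x μ - (s : ℤ) * ((P μ / s : ℕ) : ℤ) * v μ = x μ + (s : ℤ) * (-(((P μ / s : ℕ) : ℤ) * v μ)) by ring,
    Int.add_mul_ediv_left _ _ hs']
  ring

/-- **Unions of partition cubes survive periodization** (cube side `s ∣ P_μ`: the deck translations permute the cubes).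
[cite: Balaban1988Convergent, (2.13) p.256; Balaban1989LargeFieldI, p.179] -/
theorem isUnionOfCubes_periodize {s : ℕ} (hs : ∀ μ, s ∣ P μ) (hs0 : 0 < s) {n : ℕ} (hU : IsUnionOfCubes s (D n)) :
    IsUnionOfCubes s (periodize P D n) := by
  intro x y hxy
  have key : ∀ v, cubeIdx s (x - pmul P v) = cubeIdx s (y - pmul P v) := fun v => by
    funext μ
    rw [cubeIdx_sub_pmul hs hs0, cubeIdx_sub_pmul hs hs0, hxy]
  constructor
  · rintro ⟨v, hv⟩
    exact ⟨v, (hU _ _ (key v)).mp hv⟩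
  · rintro ⟨v, hv⟩
    exact ⟨v, (hU _ _ (key v)).mpr hv⟩

variable {M K : ℕ}

/-- **Periodizing a [III] (2.13)-admissible sequence with finitely many scales keeps it admissible** (cube unions at every
index, `Ω₀ = T`, `Ω_{K+1} = ∅`), provided `L^K·M ∣ P_μ` (`L, M ≥ 1`). [cite: Balaban1988Convergent, (2.13) p.256; Balaban1984PropagatorsI, Sect. A p.17; Balaban1989LargeFieldI, p.179] -/
theorem isUnionOfCubes_periodize_admissible
    (hdistD : ∀ n, ∀ x ∈ D (n + 1), ∀ y, Within ((B14.Eq213MaximalDomains.side L M (n + 1) : ℤ) - 1) x y → y ∈ D n)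
    (hcubes : ∀ n, IsUnionOfCubes (B14.Eq213MaximalDomains.side L M n) (D n)) (hK : D (K + 1) = ∅)
    (hdvdPK : ∀ μ, B14.Eq213MaximalDomains.side L M K ∣ P μ) (hMpos : 1 ≤ M) (hL : 1 ≤ L) (n : ℕ) :
    IsUnionOfCubes (B14.Eq213MaximalDomains.side L M n) (periodize P D n) := by
  rcases Nat.lt_or_ge K n with hn | hn
  · -- above `K` everything is empty: `D n ⊆ D (K+1) = ∅`
    have hsub : D n ⊆ D (K + 1) := by
      have hanti : ∀ m, D (K + 1 + m) ⊆ D (K + 1) := by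
        intro m
        induction m with
        | zero => exact le_rfl
        | succ m ih => exact (subset_of_admissible hL hMpos hdistD (K + 1 + m)).trans ih
      have := hanti (n - (K + 1))
      rwa [show K + 1 + (n - (K + 1)) = n by omega] at this
    have hempty : D n = ∅ := Set.subset_empty_iff.mp (hK ▸ hsub)
    rw [periodize_empty hempty]
    intro x y _
    simp
  · refine isUnionOfCubes_periodize (fun μ => (?_ : _ ∣ _).trans (hdvdPK μ)) ?_ (hcubes n)
    · unfold B14.Eq213MaximalDomains.side
      exact Nat.mul_dvd_mul_right (Nat.pow_dvd_pow L hn) M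
    · exact B14.Eq213MaximalDomains.side_pos hL hMpos n

/-- **THE PERIODICITY DATUM OF A PERIODIZED ADMISSIBLE SEQUENCE**, CONSTRUCTED (`M₁ ∣ M`, `L^K·M ∣ P_μ`, `Ω_{K+1} = ∅`).
[cite: Balaban1984PropagatorsII, (2.1)–(2.4) p.224; Balaban1988Convergent, (2.13) p.256; Balaban1984PropagatorsI, Sect. A p.17] -/
theorem isPeriodic_periodize
    (hdistD : ∀ n, ∀ x ∈ D (n + 1), ∀ y, Within ((B14.Eq213MaximalDomains.side L M (n + 1) : ℤ) - 1) x y → y ∈ D n)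
    (hK : D (K + 1) = ∅) (hP : ∀ μ, 0 < P μ) (hdvdPK : ∀ μ, B14.Eq213MaximalDomains.side L M K ∣ P μ) (hM₁ : 0 < M₁)
    (hMpos : 1 ≤ M) (hdvd : M₁ ∣ M) (hL : 1 ≤ L) :
    IsPeriodic M₁ L (fun n => (periodize P D n)ᶜ) P :=
  isPeriodic_of_admissible (hdistD_periodize hdistD) (periodize_empty hK) periodize_mem_iff hP
    (fun μ => ((by unfold B14.Eq213MaximalDomains.side; rw [mul_comm]; exact Nat.mul_dvd_mul_left _ hdvd) :
      M₁ * L ^ K ∣ B14.Eq213MaximalDomains.side L M K).trans (hdvdPK μ)) hM₁ hMpos hL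

variable [NeZero d]

/-- **LEMMA 2.1 (2.60)–(2.63) WITH c₁″ ON THE TORUS FOR THE PERIODIZATION OF ANY [III] (2.13)-ADMISSIBLE SEQUENCE OF THE COVER
WITH FINITELY MANY SCALES** — r11's admissibility data (`hdistD`, cube unions), `Ω₀ = T`, `Ω_{K+1} = ∅`, positive periods with
`L^K·M ∣ P_μ`, and the numerics `1 ≤ M₁`, `M₁ ∣ M`, `L ≥ 2`, `R·M_r ≤ M/M₁`, `2 ≤ M/M₁`, `δ₀ > 0`, 0 < α < 1, (2.59): the torus
theorem now consumes the cover's (non-periodic) admissible sequences directly, one period cell at a time.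
[cite: Balaban1984PropagatorsII, Lemma 2.1 (2.60)–(2.63) p.234, (2.1)–(2.4) p.224; Balaban1988Convergent, (2.13) p.256; Balaban1984PropagatorsI, Sect. A p.17; Balaban1989LargeFieldI, p.179; corrected] -/
theorem lemma21_full_torGeo_periodize
    (hdistD : ∀ n, ∀ x ∈ D (n + 1), ∀ y, Within ((B14.Eq213MaximalDomains.side L M (n + 1) : ℤ) - 1) x y → y ∈ D n)
    (hcubes : ∀ n, IsUnionOfCubes (B14.Eq213MaximalDomains.side L M n) (D n)) (h0 : D 0 = Set.univ) (hK : D (K + 1) = ∅)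
    (hP : ∀ μ, 0 < P μ) (hdvdPK : ∀ μ, B14.Eq213MaximalDomains.side L M K ∣ P μ) (hM₁ : 0 < M₁) (hMpos : 1 ≤ M)
    (hdvd : M₁ ∣ M) (hL : 2 ≤ L) (F : Finset (TSite M₁ L (fun n => (periodize P D n)ᶜ) P)) (kk : ℕ) (η R Mr : ℝ)
    (hRM : R * Mr ≤ ((M / M₁ : ℕ) : ℝ)) (hN : 2 ≤ M / M₁) {δ₀ : ℝ} (hδ : 0 < δ₀) :
    ∀ α : ℝ, 0 < α → α < 1 → B6.Cond259 d δ₀ α R Mr →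
      B6RandomWalk.Ineq260
          (torGeo (isPeriodic_periodize hdistD hK hP hdvdPK hM₁ hMpos hdvd (by omega)) F kk η R Mr) δ₀ α ∧
        B6Lemma21Repaired.Ineq261With (B6Lemma21TwoScale.c1TwoScale d δ₀ α)
          (torGeo (isPeriodic_periodize hdistD hK hP hdvdPK hM₁ hMpos hdvd (by omega)) F kk η R Mr) δ₀ α ∧
        B6Lemma21Repaired.Ineq262With (B6Lemma21TwoScale.c1TwoScale d δ₀ α)
          (torGeo (isPeriodic_periodize hdistD hK hP hdvdPK hM₁ hMpos hdvd (by omega)) F kk η R Mr) δ₀ α ∧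
        B6Lemma21Repaired.Ineq263With (B6Lemma21TwoScale.c1TwoScale d δ₀ α)
          (torGeo (isPeriodic_periodize hdistD hK hP hdvdPK hM₁ hMpos hdvd (by omega)) F kk η R Mr) δ₀ α :=
  lemma21_full_torGeo_admissible (hdistD_periodize hdistD)
    (isUnionOfCubes_periodize_admissible hdistD hcubes hK hdvdPK hMpos (by omega)) (periodize_univ h0)
    (periodize_empty hK) hM₁ hMpos hdvd hL _ F kk η R Mr hRM hN hδ

end Periodize

end Literature.MathematicalPhysics.QuantumFieldTheory.Balaban1983to89.B15LatticeCubeTorus
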